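import Literature.AlgebraicGeometry.Deformation.PointedSchemeFunctorOfPoints
import HarnessLib

/-!
# `T_x X = X(K[ε])_x` is FUNCTORIAL in the pointed `K`-scheme: the map of a pointed `K`-morphism on `K[ε]`-points is
# the transpose of the cotangent map ([GortzWedhorn2020] Prop. 6.7, «functorial in `(X, x)`»)

Layer `Literature/AlgebraicGeometry/Deformation`, namespace `Literature.AlgebraicGeometry.Deformation`.  THEOREMS ONLY (no
definition, no named fact, no instance).  Sequel of ★ `Deformation/PointedSchemeFunctorOfPoints` (`dualNumberPointsOverAtEquivDual :
X(K[ε])_x ≃ (𝔪_x/𝔪_x²)^∨`, `PointsOverAt.push : X(K[ε])_x → Y(K[ε])_{g x}`, `locHomAt_comp_right`): for a `K`-morphism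
`g : X → Y` with `g ≫ G = F` and augmentations `π_X`, `π_Y` at `x` and `g x`,

* `maximalIdeal_le_comap_stalkMap` — `𝔪_{g x} ≤ (g^♯_x)⁻¹ 𝔪_x` (the stalk map is local);
* **`dualNumberPointsOverAtEquivDual_push_toCotangent`** — for `t ∈ X(K[ε])_x` and `s ∈ 𝔪_{g x}`:
  `e_Y (t ≫ g) (s̄) = e_X (t) (\overline{g^♯_x s})`, i.e. the square
  «`X(K[ε])_x → Y(K[ε])_{g x}` over `(𝔪_x/𝔪_x²)^∨ → (𝔪_{g x}/𝔪_{g x}²)^∨ = ᵗ(dg_x^*)`» commutes on generators;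
* `dualNumberPointsOverAtEquivDual_push` — the same as an identity of linear forms,
  `e_Y (t ≫ g) = e_X (t) ∘ₗ (𝔪_{g x}/𝔪_{g x}² → 𝔪_x/𝔪_x²)` with Mathlib's `Ideal.mapCotangent` along the `K`-algebra map
  `g^♯_x` (its `K`-linearity = ★ `stalkMap_comp_stalkAlgebraMap`).

Cell `hodgecm-mathlib` (D-0151): count-neutral capital (E1 of `B-plan/F-census/SOCKETS-F.md` §4 (α)); consumer: any computation
of the differential of a morphism of fine moduli schemes / of the classifying map on tangent spaces.  Mathlib searched and used:
`Ideal.mapCotangent(_toCotangent)`, `map_nonunit`, `Scheme.Hom.stalkMap` (local).  HC_CM is proved only modulo the 7 printed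
citations until rung 0 closes.

## References
* [GortzWedhorn2020] U. Görtz, T. Wedhorn, *Algebraic Geometry I* (2nd ed. 2020): (6.4) Prop. 6.7 («functorial in `(X, x)`»), Rem. 6.8.
-/

set_option autoImplicit false

noncomputable section
universe u

open CategoryTheory AlgebraicGeometry IsLocalRing Literature.RingTheory.CompleteLocalRings
open scoped DualNumber

namespace Literature.AlgebraicGeometry.Deformation

variable {K : Type u} [Field K] {X Y : Scheme.{u}} {F : X ⟶ Spec (.of K)} {x : X} (g : X ⟶ Y)
  (G : Y ⟶ Spec (.of K)) (hg : g ≫ G = F)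

/-- The stalk map of a morphism of schemes is local: `𝔪_{g x} ≤ (g^♯_x)⁻¹ 𝔪_x`. [cite: GortzWedhorn2020, (6.4) Prop. 6.7 and Rem. 6.8] -/
theorem maximalIdeal_le_comap_stalkMap :
    maximalIdeal (Y.presheaf.stalk (g.base x)) ≤ (maximalIdeal (X.presheaf.stalk x)).comap (g.stalkMap x).hom :=
  fun s hs => map_nonunit (g.stalkMap x).hom s hs

/-- **[GortzWedhorn2020, Prop. 6.7] «functorial in `(X, x)`», on generators**: for a pointed `K`-morphism `g`, a
`K[ε]`-point `t` of `X` through `x` over `K` and `s ∈ 𝔪_{g x}`, the tangent vector of `t ≫ g` evaluated at `s̄` is the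
tangent vector of `t` evaluated at the class of `g^♯_x s` (both are the `ε`-part of the respective local homomorphism,
★ `locHomAt_comp_right`). [cite: GortzWedhorn2020, (6.4) Prop. 6.7 and Rem. 6.8] -/
theorem dualNumberPointsOverAtEquivDual_push_toCotangent
    (πX : letI := (stalkAlgebraMap F x).toAlgebra; X.presheaf.stalk x →ₐ[K] K)
    (πY : letI := (stalkAlgebraMap G (g.base x)).toAlgebra; Y.presheaf.stalk (g.base x) →ₐ[K] K)
    (t : PointsOverAt F x K[ε]) (s : ↥(maximalIdeal (Y.presheaf.stalk (g.base x)))) :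
    letI := (stalkAlgebraMap F x).toAlgebra
    letI := (stalkAlgebraMap G (g.base x)).toAlgebra
    dualNumberPointsOverAtEquivDual G (g.base x) πY (PointsOverAt.push g G hg t) ((maximalIdeal _).toCotangent s) =
      dualNumberPointsOverAtEquivDual F x πX t
        ((maximalIdeal _).toCotangent ⟨(g.stalkMap x).hom s, maximalIdeal_le_comap_stalkMap g s.2⟩) := by
  letI := (stalkAlgebraMap F x).toAlgebra
  letI := (stalkAlgebraMap G (g.base x)).toAlgebra
  rw [dualNumberPointsOverAtEquivDual_apply_toCotangent, dualNumberPointsOverAtEquivDual_apply_toCotangent]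
  exact congrArg (fun f => TrivSqZeroExt.snd ((CommRingCat.Hom.hom f) (s : Y.presheaf.stalk (g.base x))))
    (locHomAt_comp_right g t.1 t.2.1 (PointsOverAt.push g G hg t).2.1)

/-- **[GortzWedhorn2020, Prop. 6.7] «functorial in `(X, x)`», as linear forms**: the tangent vector of `t ≫ g` is the tangent
vector of `t` composed with the cotangent map `𝔪_{g x}/𝔪_{g x}² → 𝔪_x/𝔪_x²` of the `K`-algebra map `g^♯_x` (Mathlib
`Ideal.mapCotangent`; the `K`-structure of `g^♯_x` is ★ `stalkMap_comp_stalkAlgebraMap`) — i.e. `X(K[ε])_x → Y(K[ε])_{g x}` is the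
TRANSPOSE of the cotangent map under `e_X`, `e_Y`. [cite: GortzWedhorn2020, (6.4) Prop. 6.7 and Rem. 6.8] -/
theorem dualNumberPointsOverAtEquivDual_push
    (πX : letI := (stalkAlgebraMap F x).toAlgebra; X.presheaf.stalk x →ₐ[K] K)
    (πY : letI := (stalkAlgebraMap G (g.base x)).toAlgebra; Y.presheaf.stalk (g.base x) →ₐ[K] K)
    (t : PointsOverAt F x K[ε]) :
    letI := (stalkAlgebraMap F x).toAlgebra
    letI := (stalkAlgebraMap G (g.base x)).toAlgebra
    dualNumberPointsOverAtEquivDual G (g.base x) πY (PointsOverAt.push g G hg t) =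
      (dualNumberPointsOverAtEquivDual F x πX t) ∘ₗ
        ((Ideal.mapCotangent (maximalIdeal (Y.presheaf.stalk (g.base x))) (maximalIdeal (X.presheaf.stalk x))
          ({ toRingHom := (g.stalkMap x).hom
             commutes' := fun c => RingHom.congr_fun (stalkMap_comp_stalkAlgebraMap g G hg) c } :
            Y.presheaf.stalk (g.base x) →ₐ[K] X.presheaf.stalk x)
          (maximalIdeal_le_comap_stalkMap g)).restrictScalars K) := by
  letI := (stalkAlgebraMap F x).toAlgebra
  letI := (stalkAlgebraMap G (g.base x)).toAlgebra
  refine LinearMap.ext fun v => ?_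
  obtain ⟨s, rfl⟩ := (maximalIdeal _).toCotangent_surjective v
  rw [dualNumberPointsOverAtEquivDual_push_toCotangent g G hg πX πY t s, LinearMap.comp_apply]
  rfl

end Literature.AlgebraicGeometry.Deformation

end
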